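import Literature.NumberTheory.DiophantineGeometry.FunctionFieldHilbertRamification
import Literature.NumberTheory.DiophantineGeometry.FunctionFieldAdelesProofs
import Literature.NumberTheory.DiophantineGeometry.FunctionFieldGenusRiemannTheoremProofs
import Literature.NumberTheory.DiophantineGeometry.FunctionFieldDivisorsNegativeDegreeProofs
import HarnessLib

/-!
# The genus does not increase in a constant field extension (Stichtenoth Thm. 3.6.3 (b), inequality)

Sibling **proof file** (theorems only; no named facts) in the chain discharging the named fact
`hasseWeil` of `FunctionFieldZeta` (**Stichtenoth Thm. 5.2.1**, Bombieri's proof): the Stepanov bound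
(`FunctionFieldStepanovProofs`) is applied to constant field extensions `F𝔽_{q^R}` of the Galois
closure and needs their genus bounded uniformly in `R`. For the model `F' = F[X]/(φ)`,
`K' = 𝔽_q[X]/(φ)` of `FunctionFieldConstantExtension`:

* `PlaceOver.ord_algebraMap_eq_mul`, `one_le_ord_algebraMap_uniformizer`: `v_Q(y) = e(Q|P) v_P(y)`
  with `e(Q|P) = v_Q(π_P) ≥ 1` (Def. 3.1.5), for any finite extension;
* `linearIndependent_algebraMap_of_linearIndependent`: `F` and `K'` are linearly disjoint over `K`
  in `F'` (Prop. 3.6.1);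
* `finrank_adjoin_simple_le`: `[F' : K'(x)] ≤ [F : K(x)]`;
* `exists_poleDivisor`: the pole divisor `(x)_∞` with `deg (x)_∞ = [F : K(x)]` (Thm. 1.4.11, from the
  tree's `sum_neg_ord_mul_degree_eq_finrank`);
* **`genus_adjoinRoot_map_le`: `g(F'/K') ≤ g(F/K)`** — `𝓛(N(x)_∞) ↪ 𝓛(N(x)'_∞)`, Riemann's
  inequality in `F` and the Riemann–Roch theorem in `F'` (both proved in the tree). The book proves
  equality (Thm. 3.6.3 (b)) via bases of `𝓛`-spaces descending; the inequality suffices here.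

## References

* H. Stichtenoth, *Algebraic Function Fields and Codes*, 2nd ed., GTM 254, Springer 2009,
  Def. 3.1.5, Prop. 3.1.4, Prop. 3.6.1, Thm. 3.6.3, Thm. 1.4.11, Thm. 1.4.17, Thm. 1.5.17. [Stichtenoth2009]
-/

noncomputable section

open scoped Classical Polynomial IntermediateField

namespace Literature.NumberTheory.DiophantineGeometry.AlgFunctionField

open Polynomial

universe u v

/-! ### A. Orders in a finite extension: `v_Q(y) = e · v_P(y)` -/

namespace PlaceOver

section OrdTransfer

universe u' v'

variable {K : Type u} {F : Type v} [Field K] [Field F] [Algebra K F]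
variable {K' : Type u'} {F' : Type v'} [Field K'] [Field F'] [Algebra K' F'] [Algebra F F']
variable [Algebra K F'] [IsScalarTower K F F'] [Algebra K K'] [IsScalarTower K K' F']
variable [IsAlgFunctionField K F] [FiniteDimensional F F']

/-- A unit of `𝒪_P` is a unit of `𝒪_Q` for `Q` above `P`: `v_Q(u) = 0`. [cite: Stichtenoth2009, Prop. 3.1.4] -/
theorem ord_algebraMap_eq_zero_of_ord_eq_zero (Q : PlaceOver K' F') {u : F} (hu0 : u ≠ 0)
    (hu : (Q.restrict (K := K) (F := F)).ord u = 0) : Q.ord (algebraMap F F' u) = 0 := by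
  set P := Q.restrict (K := K) (F := F) with hP
  have huO : u ∈ P.toValuationSubring := (P.mem_toValuationSubring_iff_ord_nonneg hu0).2 hu.ge
  have huiO : u⁻¹ ∈ P.toValuationSubring :=
    (P.mem_toValuationSubring_iff_ord_nonneg (inv_ne_zero hu0)).2 (by rw [P.ord_inv hu0]; omega)
  have h1 := Q.ord_nonneg_of_mem ((Q.mem_restrict_iff (K := K) (F := F) u).1 huO)
  have h2 := Q.ord_nonneg_of_mem ((Q.mem_restrict_iff (K := K) (F := F) u⁻¹).1 huiO)
  rw [map_inv₀, Q.ord_inv ((_root_.map_ne_zero _).2 hu0)] at h2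
  omega

/-- **`v_Q(y) = e(Q|P) · v_P(y)`** for `y ∈ F` and a place `Q` of the finite extension `F'` above `P`,
with `e(Q|P) = v_Q(π_P)` the ramification index (Stichtenoth Def. 3.1.5, Prop. 3.1.4).
[cite: Stichtenoth2009, Def. 3.1.5 and Prop. 3.1.4] -/
theorem ord_algebraMap_eq_mul (Q : PlaceOver K' F') (y : F) :
    Q.ord (algebraMap F F' y) =
      Q.ord (algebraMap F F' ((Q.restrict (K := K) (F := F)).uniformizer : F)) *
        (Q.restrict (K := K) (F := F)).ord y := by
  set P := Q.restrict (K := K) (F := F) with hP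
  rcases eq_or_ne y 0 with rfl | hy
  · rw [map_zero, PlaceOver.ord_zero, PlaceOver.ord_zero, mul_zero]
  set n := P.ord y with hn
  set π : F := (P.uniformizer : F) with hπ
  have hπ0 : π ≠ 0 := P.coe_uniformizer_ne_zero
  have hπ1 : P.ord π = 1 := by simpa using P.ord_uniformizer_zpow 1
  set u : F := y * π ^ (-n) with hu
  have hu0 : u ≠ 0 := mul_ne_zero hy (zpow_ne_zero _ hπ0)
  have hordu : P.ord u = 0 := by
    rw [hu, P.ord_mul_eq hy (zpow_ne_zero _ hπ0), P.ord_zpow hπ0, hπ1, ← hn]; ring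
  have hy' : y = u * π ^ n := by
    rw [hu, mul_assoc, ← zpow_add₀ hπ0, neg_add_cancel, zpow_zero, mul_one]
  have hθu := Q.ord_algebraMap_eq_zero_of_ord_eq_zero (K := K) hu0 hordu
  have hπ'0 : algebraMap F F' π ≠ 0 := (_root_.map_ne_zero _).2 hπ0
  rw [hy', map_mul, map_zpow₀, Q.ord_mul_eq ((_root_.map_ne_zero _).2 hu0) (zpow_ne_zero _ hπ'0), hθu,
    Q.ord_zpow hπ'0, zero_add, mul_comm]

/-- `e(Q|P) ≥ 1`: a uniformizer of `P` is not a unit at `Q`. [cite: Stichtenoth2009, Def. 3.1.5] -/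
theorem one_le_ord_algebraMap_uniformizer (Q : PlaceOver K' F') :
    1 ≤ Q.ord (algebraMap F F' ((Q.restrict (K := K) (F := F)).uniformizer : F)) := by
  set P := Q.restrict (K := K) (F := F) with hP
  have hmem : algebraMap F F' (P.uniformizer : F) ∈ Q.toValuationSubring :=
    (Q.mem_restrict_iff (K := K) (F := F) _).1 P.uniformizer.2
  have h0 := Q.ord_nonneg_of_mem hmem
  by_contra hlt
  have hzero : Q.ord (algebraMap F F' (P.uniformizer : F)) = 0 := by omega
  -- then `π_P⁻¹ ∈ 𝒪_Q ∩ F = 𝒪_P`, absurd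
  have hπ0 : (P.uniformizer : F) ≠ 0 := P.coe_uniformizer_ne_zero
  have hinv : (algebraMap F F' (P.uniformizer : F))⁻¹ ∈ Q.toValuationSubring := by
    rw [Q.mem_toValuationSubring_iff_ord_nonneg (inv_ne_zero ((_root_.map_ne_zero _).2 hπ0)),
      Q.ord_inv ((_root_.map_ne_zero _).2 hπ0), hzero, neg_zero]
  rw [← map_inv₀] at hinv
  have hinv' : (P.uniformizer : F)⁻¹ ∈ P.toValuationSubring :=
    (Q.mem_restrict_iff (K := K) (F := F) _).2 hinv
  have h1 := P.ord_nonneg_of_mem hinv'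
  rw [P.ord_inv hπ0, show P.ord (P.uniformizer : F) = 1 by simpa using P.ord_uniformizer_zpow 1] at h1
  omega

end OrdTransfer

end PlaceOver

/-! ### B. Linear disjointness of `F` and `K'` over `K` inside `F' = F[X]/(φ)` -/

section Disjoint

variable {K : Type u} {F : Type v} [Field K] [Field F] [Algebra K F] [IsIntegrallyClosedIn K F]
variable (φ : K[X]) [hirr : Fact (Irreducible φ)]

/-- **`F` and `K' = K(α)` are linearly disjoint over `K` in `F' = F(α)`**: a `K`-linearly independent
family in `F` stays `K'`-linearly independent in `F'` (expand the coefficients in the basis `α^k` of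
`K'/K`, which is also a basis of `F'/F`; Stichtenoth Prop. 3.6.1 / proof of Thm. 3.6.3 (a)).
[cite: Stichtenoth2009, Prop. 3.6.1] -/
theorem linearIndependent_algebraMap_of_linearIndependent {ι : Type*} {v : ι → F}
    (hv : LinearIndependent K v) :
    LinearIndependent (AdjoinRoot φ) (fun i => algebraMap F (AdjoinRoot (φ.map (algebraMap K F))) (v i)) := by
  set pbK := AdjoinRoot.powerBasis hirr.out.ne_zero with hpbK
  set pbF := AdjoinRoot.powerBasis (fact_irreducible_map (F := F) φ).out.ne_zero with hpbF
  have hdim : pbK.dim = pbF.dim := by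
    rw [hpbK, hpbF, AdjoinRoot.powerBasis_dim, AdjoinRoot.powerBasis_dim, natDegree_map]
  -- `algebraMap K' F' (β^k) = α^k`
  have hbasis : ∀ k : Fin pbK.dim,
      algebraMap (AdjoinRoot φ) (AdjoinRoot (φ.map (algebraMap K F))) (pbK.basis k) =
        pbF.basis (Fin.cast hdim k) := by
    intro k
    rw [PowerBasis.coe_basis, PowerBasis.coe_basis]
    simp only [Fin.val_cast, map_pow, hpbK, hpbF, AdjoinRoot.powerBasis_gen, algebraMap_root]
  -- the reindexed power basis of `F'/F` is linearly independent over `F`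
  have hind : LinearIndependent F fun k : Fin pbK.dim => pbF.basis (Fin.cast hdim k) :=
    pbF.basis.linearIndependent.comp _ (Fin.cast_injective hdim)
  rw [linearIndependent_iff']
  intro s c hsum i hi
  set a : ι → Fin pbK.dim → K := fun j k => pbK.basis.repr (c j) k with ha
  have hc : ∀ j, c j = ∑ k, a j k • pbK.basis k := fun j => (pbK.basis.sum_repr (c j)).symm
  -- each term, regrouped along `α^k`
  have h1 : ∀ j, c j • algebraMap F (AdjoinRoot (φ.map (algebraMap K F))) (v j) =
      ∑ k, (a j k • v j) • pbF.basis (Fin.cast hdim k) := by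
    intro j
    conv_lhs => rw [hc j]
    rw [Finset.sum_smul]
    refine Finset.sum_congr rfl fun k _ => ?_
    rw [smul_assoc, smul_assoc, Algebra.smul_def (pbK.basis k), hbasis, Algebra.smul_def (v j),
      mul_comm]
  have hsum' : ∑ k, (∑ j ∈ s, a j k • v j) • pbF.basis (Fin.cast hdim k) = 0 := by
    rw [← hsum]
    simp_rw [Finset.sum_smul, h1]
    exact Finset.sum_comm
  -- all regrouped coefficients vanish, hence all `a j k`, hence `c i`
  have hcoef : ∀ k, ∑ j ∈ s, a j k • v j = 0 := fun k =>
    linearIndependent_iff'.1 hind Finset.univ (fun k => ∑ j ∈ s, a j k • v j) hsum' k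
      (Finset.mem_univ k)
  have ha0 : ∀ k, a i k = 0 := fun k => linearIndependent_iff'.1 hv s (fun j => a j k) (hcoef k) i hi
  rw [hc i]
  simp [ha0]

end Disjoint

/-! ### C. `[F' : K'(x)] ≤ [F : K(x)]` -/

section Finrank

variable {K : Type u} {F : Type v} [Field K] [Field F] [Algebra K F] [IsIntegrallyClosedIn K F]
variable (φ : K[X]) [hirr : Fact (Irreducible φ)]

/-- The image of `K(x)` in `F'` lies in `K'(x)`. [folklore] -/
theorem algebraMap_mem_adjoin_simple (x : F) {r : F} (hr : r ∈ K⟮x⟯) :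
    algebraMap F (AdjoinRoot (φ.map (algebraMap K F))) r ∈
      (AdjoinRoot φ)⟮algebraMap F (AdjoinRoot (φ.map (algebraMap K F))) x⟯ := by
  rw [IntermediateField.mem_adjoin_simple_iff] at hr
  obtain ⟨p, q, rfl⟩ := hr
  rw [map_div₀, ← aeval_algebraMap_apply, ← aeval_algebraMap_apply,
    ← aeval_map_algebraMap (AdjoinRoot φ), ← aeval_map_algebraMap (AdjoinRoot φ) _ q]
  refine div_mem ?_ ?_ <;>
    exact IntermediateField.algebra_adjoin_le_adjoin _ _ (Polynomial.aeval_mem_adjoin_singleton _ _)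

/-- **`[F' : K'(x)] ≤ [F : K(x)]`** for `x ∈ F` transcendental over `K`: `F' = F K'` is spanned over
`K'(x)` by the image of a `K(x)`-basis of `F` (in fact equality holds, Stichtenoth Prop. 3.6.1; only
the inequality is needed). [cite: Stichtenoth2009, Prop. 3.6.1] -/
theorem finrank_adjoin_simple_le [IsAlgFunctionField K F] {x : F} (hx : Transcendental K x) :
    Module.finrank (AdjoinRoot φ)⟮algebraMap F (AdjoinRoot (φ.map (algebraMap K F))) x⟯
        (AdjoinRoot (φ.map (algebraMap K F))) ≤
      Module.finrank K⟮x⟯ F := by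
  haveI := IsAlgFunctionField.finiteDimensional_adjoin_simple hx
  set F' := AdjoinRoot (φ.map (algebraMap K F)) with hF'
  set x' : F' := algebraMap F F' x with hx'
  set M' : IntermediateField (AdjoinRoot φ) F' := (AdjoinRoot φ)⟮x'⟯ with hM'
  set b := Module.finBasis K⟮x⟯ F with hb
  -- the image of `F` lies in the `K'(x)`-span of the image of the basis
  have himage : ∀ y : F, algebraMap F F' y ∈
      Submodule.span M' (Set.range fun i => algebraMap F F' (b i)) := by
    intro y
    rw [show algebraMap F F' y = algebraMap F F' (∑ i, b.repr y i • b i) by rw [b.sum_repr y], map_sum]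
    refine Submodule.sum_mem _ fun i _ => ?_
    rw [Algebra.smul_def, map_mul]
    have hmem : algebraMap F F' ((b.repr y i : K⟮x⟯) : F) ∈ M' :=
      algebraMap_mem_adjoin_simple φ x (b.repr y i).2
    have : algebraMap F F' ((b.repr y i : K⟮x⟯) : F) * algebraMap F F' (b i) =
        (⟨_, hmem⟩ : M') • algebraMap F F' (b i) := rfl
    rw [show algebraMap F F' (algebraMap K⟮x⟯ F (b.repr y i)) =
      algebraMap F F' ((b.repr y i : K⟮x⟯) : F) from rfl, this]
    exact Submodule.smul_mem _ _ (Submodule.subset_span ⟨i, rfl⟩)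
  -- hence everything: `F' = ⊕ F α^k` with `α^k ∈ K' ⊆ K'(x)`
  have hspan : Submodule.span M' (Set.range fun i => algebraMap F F' (b i)) = ⊤ := by
    apply top_unique
    intro z _
    set pbF := AdjoinRoot.powerBasis (fact_irreducible_map (F := F) φ).out.ne_zero with hpbF
    rw [← pbF.basis.sum_repr z]
    refine Submodule.sum_mem _ fun k _ => ?_
    rw [Algebra.smul_def, mul_comm]
    have hk : pbF.basis k ∈ M' := by
      rw [PowerBasis.coe_basis]
      simp only [hpbF, AdjoinRoot.powerBasis_gen]
      rw [← algebraMap_root φ, ← map_pow]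
      exact IntermediateField.algebraMap_mem _ _
    have : pbF.basis k * algebraMap F F' (pbF.basis.repr z k) =
        (⟨_, hk⟩ : M') • algebraMap F F' (pbF.basis.repr z k) := rfl
    rw [this]
    exact Submodule.smul_mem _ _ (himage _)
  calc Module.finrank M' F' = Module.finrank M' (⊤ : Submodule M' F') := (finrank_top M' F').symm
    _ = Module.finrank M' (Submodule.span M' (Set.range fun i => algebraMap F F' (b i))) := by
        rw [hspan]
    _ ≤ Fintype.card (Fin (Module.finrank K⟮x⟯ F)) := finrank_range_le_card _
    _ = Module.finrank K⟮x⟯ F := Fintype.card_fin _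

end Finrank

/-! ### D. Pole divisors and the genus comparison -/

section PoleDivisor

variable {K : Type u} {F : Type v} [Field K] [Field F] [Algebra K F] [IsAlgFunctionField K F]

/-- **The pole divisor `(x)_∞` and its degree `deg (x)_∞ = [F : K(x)]`** (Stichtenoth Def. 1.1.18 and
Thm. 1.4.11, the latter being the tree's `sum_neg_ord_mul_degree_eq_finrank`), as an existence
statement. [cite: Stichtenoth2009, Thm. 1.4.11] -/
theorem exists_poleDivisor {x : F} (hx : Transcendental K x) :
    ∃ D : Divisor K F, (∀ v, D v = ((-v.ord x).toNat : ℤ)) ∧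
      D.degree = Module.finrank K⟮x⟯ F := by
  have hx0 : x ≠ 0 := fun h => hx (h ▸ isAlgebraic_zero)
  have hfin : (Function.support fun v : PlaceOver K F => (((-v.ord x).toNat : ℕ) : ℤ)).Finite := by
    refine (finite_setOf_ord_ne_zero_of_ne_zero (K := K) hx0).subset fun v hv => ?_
    simp only [Function.mem_support, ne_eq, Nat.cast_eq_zero, Int.toNat_eq_zero, not_le] at hv
    simp only [Set.mem_setOf_eq]
    omega
  refine ⟨Finsupp.ofSupportFinite _ hfin, fun v => rfl, ?_⟩
  set D : Divisor K F := Finsupp.ofSupportFinite _ hfin with hD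
  have hDv : ∀ v, D v = ((-v.ord x).toNat : ℤ) := fun v => rfl
  rw [Divisor.degree_apply, Finsupp.sum,
    ← sum_neg_ord_mul_degree_eq_finrank hx D.support fun v hv => ?_]
  · have hfilt : D.support.filter (fun v => v.ord x < 0) = D.support := by
      apply Finset.filter_true_of_mem
      intro v hv
      rw [Finsupp.mem_support_iff, hDv] at hv
      simp only [ne_eq, Nat.cast_eq_zero, Int.toNat_eq_zero, not_le] at hv
      omega
    rw [hfilt]
    refine Finset.sum_congr rfl fun v hv => ?_
    rw [Finsupp.mem_support_iff, hDv] at hv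
    simp only [ne_eq, Nat.cast_eq_zero, Int.toNat_eq_zero, not_le] at hv
    rw [hDv, Int.toNat_of_nonneg (by omega)]
  · rw [Finsupp.mem_support_iff, hDv]
    simp only [ne_eq, Nat.cast_eq_zero, Int.toNat_eq_zero, not_le]
    omega

end PoleDivisor

section GenusLe

variable {K : Type u} {F : Type v} [Field K] [Fintype K] [Field F] [Algebra K F]
  [IsIntegrallyClosedIn K F] [IsAlgFunctionField K F]
variable (φ : K[X]) [hirr : Fact (Irreducible φ)]

/-- `((-(e o)).toNat : ℤ) = e · (-o).toNat` for `e ≥ 0`. [folklore] -/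
theorem toNat_neg_mul_eq {e o : ℤ} (he : 0 ≤ e) : ((-(e * o)).toNat : ℤ) = e * ((-o).toNat : ℤ) := by
  rcases le_or_gt o 0 with ho | ho
  · rw [Int.toNat_of_nonneg (by nlinarith), Int.toNat_of_nonneg (by omega)]; ring
  · rw [Int.toNat_eq_zero.2 (by nlinarith), Int.toNat_eq_zero.2 (by omega)]; simp

/-- **The genus does not increase in the constant field extension `F' = F𝔽_{q^t}`**:
`g(F'/K') ≤ g(F/K)` (Stichtenoth Thm. 3.6.3 (b) gives equality; only the inequality is needed for the
Hasse–Weil bound, and it is what the elementary comparison below yields). Proof: for `x ∈ F`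
transcendental, `deg (x)_∞ = [F : K(x)] =: m` in `F` and `deg (x)'_∞ = [F' : K'(x)] ≤ m` in `F'`
(Thm. 1.4.11 and `finrank_adjoin_simple_le`); `𝓛(N(x)_∞) ⊆ 𝓛(N(x)'_∞)` along `F → F'`
(`v_Q = e · v_P`), and `K`-independent elements stay `K'`-independent
(`linearIndependent_algebraMap_of_linearIndependent`), so `ℓ'(N(x)'_∞) ≥ ℓ(N(x)_∞) ≥ Nm + 1 - g`
(Riemann's inequality), while Riemann–Roch in `F'` gives `ℓ'(N(x)'_∞) = N deg (x)'_∞ + 1 - g'` for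
`N` large. [cite: Stichtenoth2009, Thm. 3.6.3(b)] -/
theorem genus_adjoinRoot_map_le :
    genus (AdjoinRoot φ) (AdjoinRoot (φ.map (algebraMap K F))) ≤ genus K F := by
  set K' := AdjoinRoot φ with hK'
  set F' := AdjoinRoot (φ.map (algebraMap K F)) with hF'
  -- a transcendental element and its image
  obtain ⟨x, hx⟩ := IsAlgFunctionField.exists_transcendental (K := K) (F := F)
  set x' : F' := algebraMap F F' x with hx'def
  have hx' : Transcendental K' x' := by
    intro halg
    apply hx
    have h1 : IsIntegral K' x' := halg.isIntegral
    have h2 : IsIntegral K x' := isIntegral_trans x' h1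
    exact ((isIntegral_algHom_iff (IsScalarTower.toAlgHom K F F') (algebraMap F F').injective).1
      h2).isAlgebraic
  -- pole divisors and degrees
  obtain ⟨Dx, hDx, hdegDx⟩ := exists_poleDivisor (K := K) hx
  obtain ⟨Dx', hDx', hdegDx'⟩ := exists_poleDivisor (K := K') hx'
  set m := Module.finrank K⟮x⟯ F with hm
  set m' := Module.finrank K'⟮x'⟯ F' with hm'
  have hmm' : m' ≤ m := finrank_adjoin_simple_le φ hx
  haveI := IsAlgFunctionField.finiteDimensional_adjoin_simple hx'
  have hm'1 : 1 ≤ m' := Module.finrank_pos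
  -- `𝓛(N(x)_∞) ↪ 𝓛(N(x)'_∞)` and `ℓ ≤ ℓ'`
  have hmem : ∀ (N : ℕ) {y : F}, y ∈ riemannRochSpace (N • Dx) →
      algebraMap F F' y ∈ riemannRochSpace (N • Dx') := by
    intro N y hy
    rcases eq_or_ne y 0 with rfl | hy0
    · rw [map_zero]; exact zero_mem _
    refine mem_riemannRochSpace_of_neg_apply_le_ord ((_root_.map_ne_zero _).2 hy0) fun Q => ?_
    set P := Q.restrict (K := K) (F := F) with hP
    set e := Q.ord (algebraMap F F' (P.uniformizer : F)) with he
    have he1 : 1 ≤ e := Q.one_le_ord_algebraMap_uniformizer (K := K)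
    have hy' := Q.ord_algebraMap_eq_mul (K := K) y
    have hxQ := Q.ord_algebraMap_eq_mul (K := K) x
    rw [← hP, ← he] at hy' hxQ
    rw [← hx'def] at hxQ
    have key := neg_apply_le_ord_of_mem_riemannRochSpace hy hy0 P
    rw [Finsupp.smul_apply, hDx, nsmul_eq_mul] at key
    rw [hx'def] at hxQ
    rw [Finsupp.smul_apply, hDx', nsmul_eq_mul, hy', hxQ, toNat_neg_mul_eq (by omega)]
    have hmul := mul_le_mul_of_nonneg_left key (by omega : (0 : ℤ) ≤ e)
    nlinarith
  have hell : ∀ N : ℕ, (ell (N • Dx) : ℤ) ≤ ell (N • Dx') := by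
    intro N
    haveI := finiteDimensional_riemannRochSpace_of_isAlgFunctionField (K := K) (F := F) (N • Dx)
    haveI := finiteDimensional_riemannRochSpace_of_isAlgFunctionField (K := K') (F := F') (N • Dx')
    set bL := Module.finBasis K (riemannRochSpace (N • Dx)) with hbL
    have hind : LinearIndependent K fun i => ((bL i : riemannRochSpace (N • Dx)) : F) :=
      bL.linearIndependent.map' (riemannRochSpace (N • Dx)).subtype (Submodule.ker_subtype _)
    have hind' := linearIndependent_algebraMap_of_linearIndependent φ hind
    let w : Fin (Module.finrank K (riemannRochSpace (N • Dx))) → riemannRochSpace (N • Dx') :=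
      fun i => ⟨algebraMap F F' ((bL i : riemannRochSpace (N • Dx)) : F), hmem N (bL i).2⟩
    have hw : LinearIndependent K' w :=
      LinearIndependent.of_comp (riemannRochSpace (N • Dx')).subtype hind'
    have h := hw.fintype_card_le_finrank
    rw [Fintype.card_fin] at h
    unfold ell
    exact_mod_cast h
  -- Riemann's inequality below, Riemann–Roch above
  set g := genus K F with hg
  set g' := genus K' F' with hg'
  set N : ℕ := 2 * g' + 1 with hN
  have hRiemann := degree_add_one_sub_ell_le_genus_holds (K := K) (F := F) (N • Dx)
  rw [map_nsmul, hdegDx] at hRiemann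
  have hdeg' : Divisor.degree (N • Dx') = (N : ℤ) * m' := by rw [map_nsmul, hdegDx', nsmul_eq_mul]
  have hRR := ell_eq_degree_add_one_sub_genus (K := K') (F := F') (A := N • Dx')
    (by rw [hdeg', hN]; push_cast; nlinarith)
  rw [hdeg'] at hRR
  have h1 := hell N
  rw [hRR] at h1
  rw [nsmul_eq_mul] at hRiemann
  have h2 : (N : ℤ) * m' ≤ (N : ℤ) * m := by exact_mod_cast Nat.mul_le_mul_left N hmm'
  rw [hg, hg']
  omega

end GenusLe

end Literature.NumberTheory.DiophantineGeometry.AlgFunctionField
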